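import Mathlib
import Literature.Analysis.FluidPDE.VorticityStretching
import Literature.Analysis.FluidPDE.NewtonKernel
import Summits.NavierStokesRegularity.NavierStokesRegularity.Theorems.ThreadingFluxCentreJetPoloidalRepresentation
import Literature.Analysis.FluidPDE.SteadyNSClassicalRegularity
import Summits.NavierStokesRegularity.NavierStokesRegularity.Theorems.ThreadingFluxCentreJetRigidityReductionSharp
import Summits.NavierStokesRegularity.NavierStokesRegularity.Theorems.UnthreadedDoorVorticityOfClass
import HarnessLib

/-!
# Crux `PoloidalLiouville` (stmt-NavierStokesRegularity-1222, wall W1): the STEADY STRATUM of the crux, in the crux's own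
# (bounded-ancient-mild) class, follows from the rigidity conjecture C1* — bridges between the «steady-centre-sieve» card
# (ns-idea-15, `CentreJetSketch.lean`) and the «precession-gap» card (ns-idea-15, `PrecessionSketch.lean`)

Support file (Theorems-side; seat ns-wall-eng-7 g5, cell ns-wall-extremal, W1 adjunct; `--supports stmt-NavierStokesRegularity-1222
--as helper`).  Three statements of the steady stratum of ⟨1222⟩ are in the tree's sketches:

* W1ˢ `CentreJet.SteadyUnthreadedLiouville` (classical, `V ∈ C³`, `p ∈ C¹` — `IsSteadyNSOn univ`);
* H₂ `Precession.SteadyPoloidalLiouville` (classical, `V ∈ C²`, `p ∈ C¹`, the equation pointwise);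
* H₂ᵐ `Precession.SteadyPoloidalLiouvilleW1` (the steady SUB-CASE OF THE CRUX VERBATIM: a bounded ancient mild solution, jointly smooth
  on the open past, CONSTANT IN TIME, unthreaded about `x₀`, is constant in space).

This file proves, bodies VERBATIM: `steadyPoloidalLiouville_of_steadyUnthreadedLiouville : W1ˢ → H₂` (a bounded `C²/C¹` steady flow is
smooth — tree `IsSteadyNSSolution.contDiff_of_bounded`, Galdi X.1.1 route); `steadyPoloidalLiouvilleW1_of_steadyPoloidalLiouville :
H₂ → H₂ᵐ` (the class solves the VORTICITY formulation classically — the landed companion stub `stub_vorticityOfClass` of the antidynamo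
skeleton; a time-independent field has `∂ₜω = 0` within the open past, so the slice `V` obeys `(V·∇)ω = (ω·∇)V + Δω`; then
`G = (V·∇)V − ΔV` is curl-free (`curl_convect_self`, `curl_laplacian`) on the simply connected `ℝ³`, hence a gradient `−∇p`
(the star-convex Poincaré lemma of `ThreadingFluxCentreJetPoloidalRepresentation`), i.e. `(V, p)` is a bounded classical STEADY flow —
the steady case of Majda–Bertozzi Prop. 2.21); and therefore, with `CentreJet.steadyUnthreadedLiouville_of_steadyLocalRigidity` (p686553):

* ★ `CentreJet.steadyPoloidalLiouvilleW1_of_steadyLocalRigidity : SteadyLocalRigidity → SteadyPoloidalLiouvilleW1` —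
  **the steady sub-case of crux ⟨1222⟩, in the crux's class, follows from C1* alone.**

HONEST LABEL: C1* `SteadyLocalRigidity` is a CONJECTURE of the card (exact linearised-sieve evidence), untouched; `PoloidalLiouville`
(1222), its steady stratum and NS regularity remain OPEN; information-grade (movement 0).
[cite: MajdaBertozziCUP2002, §2.4.4 Prop. 2.21 (steady case)] [cite: Galdi2011, Thm X.1.1]
-/

-- the summit and its single problem share the name (D-0017 nested layout)
set_option linter.dupNamespace false

noncomputable section

open Set Function Filter MeasureTheory
open scoped RealInnerProductSpace Topology ContDiff
open Literature.Analysis.FluidPDE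

namespace Summit.NavierStokesRegularity.NavierStokesRegularity.Theorems.PoloidalLiouville.CentreJet

/-! ### W1ˢ (classical, `C³/C¹`) ⇒ H₂ (classical, `C²/C¹`) -/

/-- ★ **`SteadyUnthreadedLiouville → Precession.SteadyPoloidalLiouville`** (bodies verbatim): a bounded `C²/C¹` classical steady flow on
`ℝ³` is smooth (tree `IsSteadyNSSolution.contDiff_of_bounded`), so the `C³` statement applies. -/
theorem steadyPoloidalLiouville_of_steadyUnthreadedLiouville
    (h : ∀ (V : E3 → E3) (p : E3 → ℝ) (x₀ : E3), IsSteadyNSOn univ V p → (∃ B : ℝ, ∀ x, ‖V x‖ ≤ B) →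
      IsUnthreadedAbout x₀ V → ∃ b : E3, ∀ x, V x = b) :
    ∀ (V : E3 → E3) (p : E3 → ℝ) (x₀ : E3), ContDiff ℝ 2 V → ContDiff ℝ 1 p → VectorCalculus.IsDivFree V →
      (∀ x, fderiv ℝ V x (V x) + gradient p x = Laplacian.laplacian V x) →
      (∃ B : ℝ, ∀ x, ‖V x‖ ≤ B) → IsUnthreadedAbout x₀ V → ∃ b : E3, ∀ x, V x = b := by
  intro V p x₀ hV hp hdiv heq hB hun
  obtain ⟨B, hBV⟩ := hB
  have hS : IsSteadyNSSolution 1 0 V p :=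
    { contDiff_velocity := hV
      contDiff_pressure := hp
      momentum := fun y => by rw [convect_apply, one_smul, Pi.zero_apply, ← heq y]; abel
      divFree := hdiv }
  obtain ⟨hVs, hps⟩ := hS.contDiff_of_bounded one_pos hBV
  have hNS : IsSteadyNSOn univ V p :=
    ⟨(contDiff_infty.1 hVs 3).contDiffOn, (contDiff_infty.1 hps 1).contDiffOn, fun x _ => hdiv x, fun x _ => heq x⟩
  exact h V p x₀ hNS ⟨B, hBV⟩ hun

/-! ### H₂ (classical) ⇒ H₂ᵐ (the steady sub-case of the crux, mild class) -/

/-- A family constant in time on the open past has zero time derivative within the past. -/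
theorem timeDerivWithin_eq_zero_of_const {w : ℝ → E3 → E3} (hc : ∀ s < 0, ∀ t < 0, w s = w t) {t : ℝ} (ht : t < 0)
    (x : E3) : timeDerivWithin (Iio 0) w t x = 0 := by
  unfold timeDerivWithin
  have hcongr : EqOn (fun s => w s x) (fun _ => w t x) (Iio (0 : ℝ)) := fun s hs => by
    simp only [hc s hs t ht]
  rw [derivWithin_congr hcongr (hcongr ht)]
  simp

/-- **Steady pressure from the steady vorticity equation** (the steady case of Majda–Bertozzi Prop. 2.21): a smooth divergence-free
field `V` on `ℝ³` whose vorticity `ω = curl V` satisfies `(V·∇)ω = (ω·∇)V + Δω` is a classical steady Navier–Stokes flow for some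
`C¹` pressure: `G = (V·∇)V − ΔV` has `curl G = (V·∇)ω − (ω·∇)V − Δω = 0`, hence `G = −∇p` on the simply connected `ℝ³`. -/
theorem exists_pressure_of_steady_vorticity_eq {V : E3 → E3} (hV : ContDiff ℝ ∞ V) (hdiv : VectorCalculus.IsDivFree V)
    (hveq : ∀ x, convect V (curl V) x = convect (curl V) V x + Laplacian.laplacian (curl V) x) :
    ∃ p : E3 → ℝ, ContDiff ℝ 1 p ∧ ∀ x, fderiv ℝ V x (V x) + gradient p x = Laplacian.laplacian V x := by
  have hV4 : ContDiff ℝ 4 V := contDiff_infty.1 hV 4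
  have hV3 : ContDiff ℝ 3 V := contDiff_infty.1 hV 3
  have hV2 : ContDiff ℝ 2 V := contDiff_infty.1 hV 2
  -- the curl-free field `G = (V·∇)V − ΔV`
  set G : E3 → E3 := fun x => fderiv ℝ V x (V x) - Laplacian.laplacian V x with hG
  have hconv : ContDiff ℝ 2 (fun x => fderiv ℝ V x (V x)) := (hV3.fderiv_right (m := 2) (by norm_num)).clm_apply hV2
  have hΔ : ContDiff ℝ 2 (Laplacian.laplacian V) := contDiff_laplacian (n := 2) (by exact_mod_cast hV4)
  have hGs : ContDiff ℝ 2 G := hconv.sub hΔ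
  have hcurlG : ∀ x, curl G x = 0 := by
    intro x
    rw [hG, curl_sub ((hconv.differentiable (by norm_num)) x) ((hΔ.differentiable (by norm_num)) x)]
    have h1 : curl (fun x => fderiv ℝ V x (V x)) x =
        convect V (curl V) x - convect (curl V) V x + VectorCalculus.divergence V x • curl V x := curl_convect_self hV2 x
    rw [h1, curl_laplacian hV3, hdiv x, zero_smul, add_zero, hveq x]
    abel
  -- a potential on the (star-shaped) whole space
  obtain ⟨φ, hφ⟩ := exists_hasFDerivAt_innerSL_of_curl_eq_zero_of_starConvex isOpen_univ (starConvex_univ (0 : E3))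
    ((hGs.of_le (by norm_num)).contDiffOn) (fun z _ => hcurlG z)
  have hφ2 : ContDiffOn ℝ 2 φ univ :=
    contDiffOn_two_of_hasFDerivAt_innerSL isOpen_univ ((hGs.of_le (by norm_num)).contDiffOn) hφ
  refine ⟨fun x => -φ x, ?_, fun x => ?_⟩
  · exact ((contDiffOn_univ.1 hφ2).of_le (by norm_num)).neg
  · have hneg : HasFDerivAt (fun x => -φ x) (-(innerSL ℝ (G x))) x := (hφ x (mem_univ x)).neg
    have hg : HasGradientAt (fun x => -φ x) (-G x) x := by
      rw [hasGradientAt_iff_hasFDerivAt, map_neg]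
      exact hneg
    rw [hg.gradient]
    simp only [hG]
    abel

/-- ★ **`Precession.SteadyPoloidalLiouville → Precession.SteadyPoloidalLiouvilleW1`** (bodies verbatim): a bounded ancient mild solution,
jointly smooth on the open past and constant in time, is a bounded classical steady flow for SOME `C¹` pressure — the class solves the
vorticity formulation (`stub_vorticityOfClass`), `∂ₜω = 0` for a time-independent field, and the steady vorticity equation integrates to
the steady momentum equation (`exists_pressure_of_steady_vorticity_eq`). -/
theorem steadyPoloidalLiouvilleW1_of_steadyPoloidalLiouville
    (h : ∀ (V : E3 → E3) (p : E3 → ℝ) (x₀ : E3), ContDiff ℝ 2 V → ContDiff ℝ 1 p → VectorCalculus.IsDivFree V →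
      (∀ x, fderiv ℝ V x (V x) + gradient p x = Laplacian.laplacian V x) →
      (∃ B : ℝ, ∀ x, ‖V x‖ ≤ B) → IsUnthreadedAbout x₀ V → ∃ b : E3, ∀ x, V x = b) :
    ∀ (v : ℝ → E3 → E3) (x₀ : E3),
      IsBoundedAncientMildSolution 1 v → (∀ t < 0, AEStronglyMeasurable (v t) volume) →
      ContDiffOn ℝ (⊤ : ℕ∞) (uncurry v) (Iio 0 ×ˢ univ) → (∀ s < 0, ∀ t < 0, v s = v t) →
      (∀ t < 0, ∀ x, inner ℝ (x - x₀) (curl (v t) x) = 0) →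
      ∀ t < 0, ∃ b : E3, ∀ x, v t x = b := by
  intro v x₀ hB hmeas hsm hconst hun t ht
  -- the class solves the vorticity formulation classically
  have hvort : IsVorticitySolutionOn (Iio 0) 1 v := (stub_vorticityOfClass v hB hmeas hsm).1
  have htS : t ∈ Iio (0 : ℝ) := ht
  have hVs : ContDiff ℝ ∞ (v t) := hvort.contDiff_velocity htS
  -- `∂ₜω = 0` within the past, so the slice obeys the steady vorticity equation
  have hωconst : ∀ s < 0, ∀ t < 0, vorticity v s = vorticity v t := fun s hs t' ht' => by
    simp only [vorticity_apply, hconst s hs t' ht']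
  have hveq : ∀ x, convect (v t) (curl (v t)) x = convect (curl (v t)) (v t) x + Laplacian.laplacian (curl (v t)) x := by
    intro x
    have h := hvort.vorticity_eq t htS x
    rw [timeDerivWithin_eq_zero_of_const hωconst ht, zero_add, vorticity_apply, one_smul] at h
    exact h
  obtain ⟨p, hp, heq⟩ := exists_pressure_of_steady_vorticity_eq hVs (hvort.divFree t htS) hveq
  obtain ⟨C, hC⟩ := hB.isBoundedOn
  exact h (v t) p x₀ (contDiff_infty.1 hVs 2) hp (hvort.divFree t htS) heq ⟨C, fun x => hC t ht x⟩ (hun t ht)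

/-! ### The steady sub-case of crux ⟨1222⟩ from C1* alone -/

/-- ★★ **`SteadyLocalRigidity → Precession.SteadyPoloidalLiouvilleW1`** (bodies verbatim): given ONLY the (conjectural) master local
rigidity C1* of the «steady-centre-sieve» card, every bounded ancient mild solution of Navier–Stokes on `ℝ³ × (−∞, 0)` that is jointly
smooth, CONSTANT IN TIME and unthreaded about some `x₀` (vortex lines on the spheres about `x₀`) is constant — the steady sub-case of
`PoloidalLiouville` (1222) in the crux's own class. -/
theorem steadyPoloidalLiouvilleW1_of_steadyLocalRigidity
    (hC1 : ∀ (V : E3 → E3) (p : E3 → ℝ) (x₀ : E3) (ρ : ℝ), 0 < ρ →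
      AnalyticOnNhd ℝ V (Metric.ball x₀ ρ) → AnalyticOnNhd ℝ p (Metric.ball x₀ ρ) →
      IsSteadyNSOn (Metric.ball x₀ ρ) V p → (∀ x ∈ Metric.ball x₀ ρ, inner ℝ (x - x₀) (curl V x) = 0) →
      (∃ x ∈ Metric.ball x₀ ρ, curl V x ≠ 0) →
      ∃ g : E3 ≃ₗᵢ[ℝ] E3,
        (∀ θ : ℝ, ∀ y : E3, ‖y‖ < ρ → g.symm (V (x₀ + g (rotZ θ y))) = rotZ θ (g.symm (V (x₀ + g y)))) ∧
        ∀ y : E3, ‖y‖ < ρ → swirl (fun z => g.symm (V (x₀ + g z))) y = 0) :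
    ∀ (v : ℝ → E3 → E3) (x₀ : E3),
      IsBoundedAncientMildSolution 1 v → (∀ t < 0, AEStronglyMeasurable (v t) volume) →
      ContDiffOn ℝ (⊤ : ℕ∞) (uncurry v) (Iio 0 ×ˢ univ) → (∀ s < 0, ∀ t < 0, v s = v t) →
      (∀ t < 0, ∀ x, inner ℝ (x - x₀) (curl (v t) x) = 0) →
      ∀ t < 0, ∃ b : E3, ∀ x, v t x = b :=
  steadyPoloidalLiouvilleW1_of_steadyPoloidalLiouville
    (steadyPoloidalLiouville_of_steadyUnthreadedLiouville (steadyUnthreadedLiouville_of_steadyLocalRigidity hC1))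

end Summit.NavierStokesRegularity.NavierStokesRegularity.Theorems.PoloidalLiouville.CentreJet

end
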